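import Summits.AtomisticToContinuum.HydrodynamicLimit.Theorems.LambertianContactSwapLambertianEulerCollisionalWindowRestart
import Summits.AtomisticToContinuum.HydrodynamicLimit.Theorems.LambertianContactSwapLambertianEulerCollisionalClampSplit
import Summits.AtomisticToContinuum.HydrodynamicLimit.Theorems.LambertianContactSwapLambertianEulerCollisionalJumpWindows
import Summits.AtomisticToContinuum.HydrodynamicLimit.Theorems.LambertianContactSwapLambertianEulerStaticsLipschitz
import Summits.AtomisticToContinuum.HydrodynamicLimit.Theorems.LambertianContactSwapLambertianEulerKineticArith
import Summits.AtomisticToContinuum.HydrodynamicLimit.Theorems.LambertianContactSwapLambertianEulerKlLedger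
import Summits.AtomisticToContinuum.HydrodynamicLimit.Theorems.LambertianContactSwapLambertianEulerProductionSplit
import HarnessLib

/-!
# The frame of the collisional heart: the counter-term and the compensated jump clamped in time (line `Sketch`, crux stmt-11854)

Support file (`--supports stmt-AtomisticToContinuum-11854`).  Frame plumbing of lead c8's derivation
`CCW-Λ → CAT-Λ → TL1G-Λ → CollisionalOneBlockInMeanLambdaLog` (`…CollisionalHeartOfInputs`): the extensive identity
`ε_N (N+1)^{4/3} = σ (N+1)` of the truncation levels (`hsDiameter_mul_rpow`, `jumpLevel_mul_window`); the invariance of the compensated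
jump under the initial free flight (`Jcol_freeFlight`); the collisional counter-term of a classical hs-Euler solution clamped in time to
`[0,t]` as a measurable observable of cubic growth equal to `Xcol` on `[0,t]` (`exists_Xframe`: derivatives of jointly smooth fields are jointly
smooth, `Z, Z′` continuous on the analyticity band of the equation of state); the compensated jump of the reference exponent clamped in time
as a measurable energy-dominated observable equal to `Jcol` on `[0,t]` (`measurable_compJump`, `abs_compJump_le`, `exists_Jframe`).

Lead prover-line-stmt-AtomisticToContinuum-11854-c8-0, 2026-08-17.  [cite: Yau1991, §2]
-/

noncomputable section

namespace Summit.AtomisticToContinuum.HydrodynamicLimit.Theorems.LambertianContactSwapLambertianEulerCollisionalFrame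

open scoped BigOperators Topology ENNReal InnerProductSpace
open MeasureTheory ProbabilityTheory Filter Set InformationTheory
open Literature.MathematicalPhysics.KineticTheory
open Literature.Analysis.FluidPDE Literature.Analysis.FluidPDE.Alexander
open Literature.Analysis.FunctionSpaces
open Summit.AtomisticToContinuum.HydrodynamicLimit.Theorems
open Summit.AtomisticToContinuum.HydrodynamicLimit.Theorems.ClampedCurrentsDockPathwise (gExp gSum DgSum)
open Summit.AtomisticToContinuum.HydrodynamicLimit.Theorems.LambertianContactSwapLambertianEulerCollisionalInputs
open Summit.AtomisticToContinuum.HydrodynamicLimit.Theorems.LambertianContactSwapLambertianEulerProductionSplitTools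
open Summit.AtomisticToContinuum.HydrodynamicLimit.Theorems.LambertianContactSwapLambertianEulerExpectedWindowProductionTools
open Summit.AtomisticToContinuum.HydrodynamicLimit.Theorems.LambertianContactSwapLambertianEulerWindowCocycle
open Summit.AtomisticToContinuum.HydrodynamicLimit.Theorems.LambertianContactSwapLambertianEulerRestartInLaw
open Summit.AtomisticToContinuum.HydrodynamicLimit.Theorems.LambertianContactSwapLambertianEulerTimeLedgerStopping
open Summit.AtomisticToContinuum.HydrodynamicLimit.Theorems.LambertianContactSwapLambertianEulerHearts

/-! ## §1 Two elementary facts -/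

/-- `ε_N (N+1)^{4/3} = σ (N+1)`: the per-contact level times the typical window count is extensive. [folklore] -/
theorem hsDiameter_mul_rpow (σ : ℝ) (N : ℕ) :
    hsDiameter σ N * ((N : ℝ) + 1) ^ (4 / 3 : ℝ) = σ * ((N : ℝ) + 1) := by
  have hN : (0 : ℝ) < (N : ℝ) + 1 := by positivity
  rw [hsDiameter, Nat.cast_add, Nat.cast_one, mul_assoc, ← Real.rpow_add hN]
  norm_num

/-- The window truncation level is extensive: `ℓ_N · R₀ h (N+1)^{4/3} = c_J σ V² R₀ h · (N+1)`. [folklore] -/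
theorem jumpLevel_mul_window (σ : ℝ) (N : ℕ) (cJ V R₀ h : ℝ) :
    jumpLevel σ N cJ V * (R₀ * h * ((N : ℝ) + 1) ^ (4 / 3 : ℝ)) = (cJ * σ * V ^ 2 * R₀ * h) * ((N : ℝ) + 1) := by
  unfold jumpLevel
  linear_combination (cJ * V ^ 2 * R₀ * h) * hsDiameter_mul_rpow σ N

/-- The compensated jump observable sees a post-collisional state only through its exit configuration: it is invariant under the
initial free flight (`exitCfg_freeFlight`). [folklore] -/
theorem Jcol_freeFlight (σ : ℝ) (Rf : ℝ → ℝ) (ρ θ : ℝ → T3 → ℝ) (u : ℝ → T3 → V3) (N : ℕ) (t : ℝ)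
    (w : Config (N + 1) (Fin 3) T3) {v : ℝ} (hv : 0 ≤ v)
    (hlt : ENNReal.ofReal v < freeExitTime (Torus.geometry (Fin 3)) (hsDiameter σ N) w)
    (hne : freeExitTime (Torus.geometry (Fin 3)) (hsDiameter σ N) w ≠ ⊤) :
    Jcol σ Rf ρ θ u N t (freeFlight (Torus.geometry (Fin 3)) v w) = Jcol σ Rf ρ θ u N t w := by
  unfold Jcol
  rw [exitCfg_freeFlight hv hlt.le hne]

/-! ## §2 The counter-term clamped in time: a measurable cubic observable equal to `Xcol` on `[0, t]` -/

/-- **The collisional counter-term of a classical hs-Euler solution, clamped in time to `[0,t]`, is a measurable observable of cubic growth**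
(derivatives of jointly smooth fields are jointly smooth; `Z, Z′` are continuous on the analyticity band of the equation of state,
`ClampedCurrentsDockEos.stub_eos`), together with a bound of the clamp centre `u`. [folklore] -/
theorem exists_Xframe : ∀ (r : ℝ) (Rf : ℝ → ℝ), 0 < r →
      (∀ x ∈ Set.Ioo (-r) r, 0 < Rf x ∧ Rf x * (∑' j : ℕ, bE j / (j.factorial : ℝ) * (x * Rf x) ^ j) = 1) →
      (∀ x ∈ Set.Icc 0 r, 1 ≤ Rf x ∧ Rf x ≤ 2) → ContinuousOn Rf (Set.Icc 0 r) →
      (∀ x ∈ Set.Ioo (-r) r, ∀ R ∈ Set.Icc (1 / 2 : ℝ) 2,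
        R * (∑' j : ℕ, bE j / (j.factorial : ℝ) * (x * R) ^ j) = 1 → R = Rf x) →
    ∃ η₁ : ℝ, 0 < η₁ ∧ ∀ {σ : ℝ}, 0 < σ → ∀ {T : ℝ} {ρ θ : ℝ → T3 → ℝ} {u : ℝ → T3 → V3}, IsHardSphereEulerSolution σ T ρ u θ →
      (∀ t ∈ Set.Ico 0 T, ∀ x, ρ t x * σ ^ 3 < η₁) → ∀ {t : ℝ}, 0 < t → t < T →
      ∃ (GX : ℝ × (T3 × V3) → ℝ) (CX W : ℝ), Measurable GX ∧ 0 ≤ CX ∧ 0 ≤ W ∧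
        (∀ q, |GX q| ≤ CX * (1 + ‖q.2.2‖) ^ 3) ∧
        (∀ r' ∈ Set.Icc 0 t, ∀ y : T3 × V3, GX (r', y) = Xcol σ ρ θ u r' y) ∧
        (∀ q : ℝ × (T3 × V3), GX q = Xcol σ ρ θ u (max 0 (min q.1 t)) q.2) ∧
        (∀ (r' : ℝ) (x : T3), ‖u (max 0 (min r' t)) x‖ ≤ W) ∧
        Continuous (fun p : ℝ × T3 => u (max 0 (min p.1 t)) p.2) := by
  intro r Rf hr hsol hbd hcont huniq
  obtain ⟨η₁, hη₁, -, F, hFan, hFeq, -⟩ := ClampedCurrentsDockEos.stub_eos r Rf hr hsol hbd hcont huniq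
  refine ⟨η₁, hη₁, fun {σ} hσ {T ρ θ u} hE hband1 {t} ht htT => ?_⟩
  have hU : UniqueDiffOn ℝ (Set.Ico (0 : ℝ) T) := uniqueDiffOn_Ico 0 T
  have h0t : (0 : ℝ) ≤ t := ht.le
  set c : ℝ → ℝ := fun r' => max 0 (min r' t) with hc_def
  have hcm : ∀ r', c r' ∈ Set.Icc 0 t := fun r' => ⟨le_max_left _ _, max_le h0t (min_le_right _ _)⟩
  have hcmT : ∀ r', c r' ∈ Set.Ico 0 T := fun r' => ⟨(hcm r').1, (hcm r').2.trans_lt htT⟩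
  have hcr : ∀ r' ∈ Set.Icc 0 t, c r' = r' := fun r' hr' => by
    simp only [hc_def, min_eq_left hr'.2, max_eq_right hr'.1]
  have hcc : ∀ r', c (c r') = c r' := fun r' => hcr _ (hcm r')
  have hΘc : Continuous fun p : ℝ × T3 => θ (c p.1) p.2 :=
    continuous_clamp hE.smooth_temperature.continuousOn_stLift le_rfl h0t htT
  have hUc : Continuous fun p : ℝ × T3 => u (c p.1) p.2 :=
    continuous_clamp hE.smooth_velocity.continuousOn_stLift le_rfl h0t htT
  have hPc : Continuous fun p : ℝ × T3 => ρ (c p.1) p.2 :=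
    continuous_clamp hE.smooth_density.continuousOn_stLift le_rfl h0t htT
  have hdΘ : ∀ k, Continuous fun p : ℝ × T3 => Torus.partialDeriv k (θ (c p.1)) p.2 := fun k =>
    continuous_clamp (hE.smooth_temperature.partialDeriv hU k).continuousOn_stLift le_rfl h0t htT
  have hQ : ∀ k, Torus.IsSmoothSpaceTimeOn (Set.Ico 0 T) (fun t y => u t y k / θ t y) := fun k =>
    ContDiffOn.div (hE.smooth_velocity.apply k) hE.smooth_temperature fun p hp =>
      (hE.temperature_pos p.1 (Set.mem_prod.1 hp).1 _).ne'
  have hdQ : ∀ k, Continuous fun p : ℝ × T3 =>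
      Torus.partialDeriv k (fun y => u (c p.1) y k / θ (c p.1) y) p.2 := fun k =>
    continuous_clamp ((hQ k).partialDeriv hU k).continuousOn_stLift le_rfl h0t htT
  have hΘ0 : ∀ p : ℝ × T3, θ (c p.1) p.2 ≠ 0 := fun p => (hE.temperature_pos _ (hcmT p.1) _).ne'
  -- the EOS on the band: `Z`, `Z′` continuous
  have hZ : ∀ η ∈ Set.Ioo 0 η₁, hsCompressibility η = 1 + η * deriv F η := by
    intro η hη
    have hev : hsExcessFreeEnergy =ᶠ[𝓝 η] F :=
      eventuallyEq_of_mem (isOpen_Ioo.mem_nhds hη) fun z hz => hFeq ⟨hz.1.le, hz.2⟩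
    rw [hsCompressibility, hev.deriv_eq]
  have hFan' : AnalyticOnNhd ℝ (fun η => 1 + η * deriv F η) (Set.Ioo 0 η₁) := fun η hη =>
    analyticAt_const.fun_add (analyticAt_id.fun_mul (hFan.deriv η ⟨by linarith [hη.1], hη.2⟩))
  have hZs : ContDiffOn ℝ (⊤ : ℕ∞) hsCompressibility (Set.Ioo 0 η₁) :=
    hFan'.contDiffOn_of_completeSpace.congr fun η hη => hZ η hη
  have hZc : ContinuousOn hsCompressibility (Set.Ioo 0 η₁) := hZs.continuousOn
  have hZ'c : ContinuousOn (deriv hsCompressibility) (Set.Ioo 0 η₁) :=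
    hZs.continuousOn_deriv_of_isOpen isOpen_Ioo (by simp)
  have hbandc1 : ∀ p : ℝ × T3, ρ (c p.1) p.2 * σ ^ 3 ∈ Set.Ioo 0 η₁ := fun p =>
    ⟨mul_pos (hE.density_pos _ (hcmT p.1) _) (pow_pos hσ 3), hband1 _ (hcmT p.1) _⟩
  have hZcc : Continuous fun p : ℝ × T3 => hsCompressibility (ρ (c p.1) p.2 * σ ^ 3) :=
    hZc.comp_continuous (hPc.mul continuous_const) hbandc1
  have hZ'cc : Continuous fun p : ℝ × T3 => deriv hsCompressibility (ρ (c p.1) p.2 * σ ^ 3) :=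
    hZ'c.comp_continuous (hPc.mul continuous_const) hbandc1
  set GX : ℝ × (T3 × V3) → ℝ := fun q => Xcol σ ρ θ u (c q.1) q.2 with hGX
  have hGXm : Measurable GX :=
    (continuous_X_aux (σ := σ) (Θc := fun p => θ (c p.1) p.2) (Pc := fun p => ρ (c p.1) p.2)
      (Zc := fun p => hsCompressibility (ρ (c p.1) p.2 * σ ^ 3))
      (Z'c := fun p => deriv hsCompressibility (ρ (c p.1) p.2 * σ ^ 3)) (Uc := fun p => u (c p.1) p.2)
      (dΘ := fun k p => Torus.partialDeriv k (θ (c p.1)) p.2)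
      (dQ := fun k p => Torus.partialDeriv k (fun y => u (c p.1) y k / θ (c p.1) y) p.2)
      hΘc hPc hZcc hZ'cc hUc hdΘ hdQ hΘ0).measurable
  obtain ⟨CX, hCX0, hCX⟩ := exists_abs_X_le (σ := σ) (Θc := fun p => θ (c p.1) p.2)
      (Pc := fun p => ρ (c p.1) p.2) (Zc := fun p => hsCompressibility (ρ (c p.1) p.2 * σ ^ 3))
      (Z'c := fun p => deriv hsCompressibility (ρ (c p.1) p.2 * σ ^ 3)) (Uc := fun p => u (c p.1) p.2)
      (dΘ := fun k p => Torus.partialDeriv k (θ (c p.1)) p.2)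
      (dQ := fun k p => Torus.partialDeriv k (fun y => u (c p.1) y k / θ (c p.1) y) p.2)
      hΘc hPc hZcc hZ'cc hUc hdΘ hdQ hΘ0 0 t
  obtain ⟨W, hW0, hW⟩ := exists_forall_norm_le_window hUc 0 t
  refine ⟨GX, CX, W, hGXm, hCX0, hW0, fun q => ?_, fun r' hr' y => ?_, fun q => rfl, fun r' x => ?_, hUc⟩
  · have h := hCX (c q.1) (hcm q.1) q.2.1 q.2.2
    simp only [hcc] at h
    exact h
  · simp only [hGX, hcr r' hr']
  · have h := hW (c r') (hcm r') x
    simp only [hcc] at h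
    exact h

/-! ## §3 The compensated jump clamped in time: measurable, energy-dominated, invariant, equal to `Jcol` on `[0, t]` -/

/-- **Measurability of a compensated jump**: for a jointly measurable time-dependent observable `F`, the noise-averaged jump of `F` at the
Lambertian redraw of the exit configuration, `(t, w) ↦ E_ξ[F_t(redraw of w♭)] − F_t(w♭)`, is jointly measurable. [folklore] -/
theorem measurable_compJump {σ : ℝ} (hσ : 0 < σ) (hσi : σ < 2⁻¹) (N : ℕ) {F : ℝ → Config (N + 1) (Fin 3) T3 → ℝ}
    (hF : Measurable (Function.uncurry F)) :
    Measurable fun q : ℝ × Config (N + 1) (Fin 3) T3 =>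
      (∫ ξ, F q.1 (lambertStepMap (Torus.geometry (Fin 3)) (incomingPairs (Torus.geometry (Fin 3)) (hsDiameter σ N)
          (freeFlight (Torus.geometry (Fin 3)) (freeExitTime (Torus.geometry (Fin 3)) (hsDiameter σ N) q.2).toReal q.2))
          (freeFlight (Torus.geometry (Fin 3)) (freeExitTime (Torus.geometry (Fin 3)) (hsDiameter σ N) q.2).toReal q.2) ξ)
        ∂(stdGaussian V3)) -
      F q.1 (freeFlight (Torus.geometry (Fin 3)) (freeExitTime (Torus.geometry (Fin 3)) (hsDiameter σ N) q.2).toReal q.2) := by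
  have hε' : hsDiameter σ N < 2⁻¹ := (hsDiameter_le hσ.le N).trans_lt hσi
  have hGeo : (Torus.geometry (Fin 3)).IsHardSphereRegular (hsDiameter σ N) := Torus.isHardSphereRegular_geometry hε'
  have hGm : (Torus.geometry (Fin 3)).IsMeasurable := Torus.isMeasurable_geometry
  have hexit : Measurable fun w : Config (N + 1) (Fin 3) T3 =>
      freeFlight (Torus.geometry (Fin 3)) (freeExitTime (Torus.geometry (Fin 3)) (hsDiameter σ N) w).toReal w :=
    hGm.measurable_freeFlight₂.comp (((measurable_freeExitTime hGeo hGm).ennreal_toReal).prodMk measurable_id)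
  have hI : Measurable fun q : ℝ × Config (N + 1) (Fin 3) T3 =>
      ∫ ξ, Function.uncurry F (q.1, lambertStepMap (Torus.geometry (Fin 3)) (incomingPairs (Torus.geometry (Fin 3)) (hsDiameter σ N)
          (freeFlight (Torus.geometry (Fin 3)) (freeExitTime (Torus.geometry (Fin 3)) (hsDiameter σ N) q.2).toReal q.2))
          (freeFlight (Torus.geometry (Fin 3)) (freeExitTime (Torus.geometry (Fin 3)) (hsDiameter σ N) q.2).toReal q.2) ξ)
        ∂(stdGaussian V3) :=
    ((hF.comp ((measurable_fst.comp measurable_fst).prodMk (measurable_lambertStepMap_incomingPairs hGm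
      (hexit.comp (measurable_snd.comp measurable_fst)) measurable_snd))).stronglyMeasurable.integral_prod_right'
      (ν := stdGaussian V3)).measurable
  have hS : Measurable fun q : ℝ × Config (N + 1) (Fin 3) T3 => Function.uncurry F
      (q.1, freeFlight (Torus.geometry (Fin 3)) (freeExitTime (Torus.geometry (Fin 3)) (hsDiameter σ N) q.2).toReal q.2) :=
    hF.comp (measurable_fst.prodMk (hexit.comp measurable_snd))
  exact hI.sub hS

/-- **Energy domination of a compensated jump**: if `|F_t(w)| ≤ C(1 + E(w))` for all `t, w`, then the compensated jump is
`≤ 2C(1 + E(w))` (the redraw and the free flight do not increase the kinetic energy). [folklore] -/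
theorem abs_compJump_le {σ : ℝ} (N : ℕ) {F : ℝ → Config (N + 1) (Fin 3) T3 → ℝ} {C : ℝ} (hC0 : 0 ≤ C)
    (hFC : ∀ (t : ℝ) (w : Config (N + 1) (Fin 3) T3), |F t w| ≤ C * (1 + configEnergy w)) (q : ℝ × Config (N + 1) (Fin 3) T3) :
    |(∫ ξ, F q.1 (lambertStepMap (Torus.geometry (Fin 3)) (incomingPairs (Torus.geometry (Fin 3)) (hsDiameter σ N)
          (freeFlight (Torus.geometry (Fin 3)) (freeExitTime (Torus.geometry (Fin 3)) (hsDiameter σ N) q.2).toReal q.2))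
          (freeFlight (Torus.geometry (Fin 3)) (freeExitTime (Torus.geometry (Fin 3)) (hsDiameter σ N) q.2).toReal q.2) ξ)
        ∂(stdGaussian V3)) -
      F q.1 (freeFlight (Torus.geometry (Fin 3)) (freeExitTime (Torus.geometry (Fin 3)) (hsDiameter σ N) q.2).toReal q.2)| ≤
      2 * C * (1 + configEnergy q.2) := by
  have hEexit : configEnergy (freeFlight (Torus.geometry (Fin 3))
      (freeExitTime (Torus.geometry (Fin 3)) (hsDiameter σ N) q.2).toReal q.2) = configEnergy q.2 :=
    configEnergy_freeFlight _ _ _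
  have hFE : ∀ (w : Config (N + 1) (Fin 3) T3), configEnergy w ≤ configEnergy q.2 → |F q.1 w| ≤ C * (1 + configEnergy q.2) :=
    fun w hw => (hFC _ w).trans (mul_le_mul_of_nonneg_left (add_le_add le_rfl hw) hC0)
  have h2 := hFE _ hEexit.le
  have h1 : |∫ ξ, F q.1 (lambertStepMap (Torus.geometry (Fin 3)) (incomingPairs (Torus.geometry (Fin 3)) (hsDiameter σ N)
          (freeFlight (Torus.geometry (Fin 3)) (freeExitTime (Torus.geometry (Fin 3)) (hsDiameter σ N) q.2).toReal q.2))
          (freeFlight (Torus.geometry (Fin 3)) (freeExitTime (Torus.geometry (Fin 3)) (hsDiameter σ N) q.2).toReal q.2) ξ)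
        ∂(stdGaussian V3)| ≤ C * (1 + configEnergy q.2) := by
    have hb := norm_integral_le_of_norm_le_const (μ := stdGaussian V3)
      (f := fun ξ => F q.1 (lambertStepMap (Torus.geometry (Fin 3)) (incomingPairs (Torus.geometry (Fin 3)) (hsDiameter σ N)
          (freeFlight (Torus.geometry (Fin 3)) (freeExitTime (Torus.geometry (Fin 3)) (hsDiameter σ N) q.2).toReal q.2))
          (freeFlight (Torus.geometry (Fin 3)) (freeExitTime (Torus.geometry (Fin 3)) (hsDiameter σ N) q.2).toReal q.2) ξ))
      (C := C * (1 + configEnergy q.2)) (Eventually.of_forall fun ξ => ?_)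
    · rwa [probReal_univ, mul_one, Real.norm_eq_abs] at hb
    · rw [Real.norm_eq_abs]
      exact hFE _ ((LambertianContactSwapLambertianEulerCollisionCompensator.configEnergy_lambertStepMap_le _ _).trans hEexit.le)
  calc _ ≤ C * (1 + configEnergy q.2) + C * (1 + configEnergy q.2) := (abs_sub _ _).trans (add_le_add h1 h2)
    _ = 2 * C * (1 + configEnergy q.2) := by ring

/-- **The compensated jump of the reference exponent, clamped in time to `[0,t]`, is a measurable energy-dominated observable**,
invariant under the initial free flight of the state, and equal to `Jcol` at times of `[0,t]`. [folklore] -/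
theorem exists_Jframe : ∀ (r : ℝ) (Rf : ℝ → ℝ), 0 < r →
      (∀ x ∈ Set.Icc 0 r, 1 ≤ Rf x ∧ Rf x ≤ 2) →
      (∀ x ∈ Set.Ioo (-r) r, ∀ R ∈ Set.Icc (1 / 2 : ℝ) 2,
        R * (∑' j : ℕ, bE j / (j.factorial : ℝ) * (x * R) ^ j) = 1 → R = Rf x) →
    ∃ ηs : ℝ, 0 < ηs ∧ ∀ {σ : ℝ}, 0 < σ → σ < 2⁻¹ → ∀ {T : ℝ} {ρ θ : ℝ → T3 → ℝ} {u : ℝ → T3 → V3},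
      IsHardSphereEulerSolution σ T ρ u θ → (∀ t ∈ Set.Ico 0 T, ∀ x, ρ t x * σ ^ 3 < ηs) → ∀ {t : ℝ}, 0 < t → t < T → ∀ N : ℕ,
      ∃ (Jc : ℝ × Config (N + 1) (Fin 3) T3 → ℝ) (D : ℝ), Measurable Jc ∧ 0 ≤ D ∧
        (∀ q, |Jc q| ≤ D * (1 + configEnergy q.2)) ∧
        (∀ (t' : ℝ) (w : Config (N + 1) (Fin 3) T3) (v : ℝ), 0 ≤ v →
          ENNReal.ofReal v < freeExitTime (Torus.geometry (Fin 3)) (hsDiameter σ N) w →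
          freeExitTime (Torus.geometry (Fin 3)) (hsDiameter σ N) w ≠ ⊤ →
          Jc (t', freeFlight (Torus.geometry (Fin 3)) v w) = Jc (t', w)) ∧
        (∀ q : ℝ × Config (N + 1) (Fin 3) T3, Jc q = Jcol σ Rf ρ θ u N (max 0 (min q.1 t)) q.2) ∧
        (∀ t' ∈ Set.Icc 0 t, ∀ w : Config (N + 1) (Fin 3) T3, Jc (t', w) = Jcol σ Rf ρ θ u N t' w) := by
  intro r Rf hr hbd huniq
  obtain ⟨ηs, hηs, hηsr, Hsm⟩ := LambertianContactSwapLambertianEulerEstimateOfHearts.isSmoothSpaceTimeOn_activityRf hr huniq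
  refine ⟨ηs, hηs, fun {σ} hσ hσi {T ρ θ u} hE hbands {t} ht htT N => ?_⟩
  have h0t : (0 : ℝ) ≤ t := ht.le
  have htT' : 0 + t < T := by rw [zero_add]; exact htT
  -- the reference activity is smooth and positive on `[0, T)`
  have hσ3 : 0 < σ ^ 3 := by positivity
  have hrange : ∀ t' ∈ Set.Ico 0 T, ∀ x, 0 < σ ^ 3 * ρ t' x ∧ σ ^ 3 * ρ t' x < ηs := fun t' ht' x =>
    ⟨mul_pos hσ3 (hE.density_pos t' ht' x), by rw [mul_comm]; exact hbands t' ht' x⟩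
  have hsm : Torus.IsSmoothSpaceTimeOn (Set.Ico 0 T) (fun t' x => ρ t' x * Rf (σ ^ 3 * ρ t' x)) :=
    Hsm hE.smooth_density hrange
  have hapos : ∀ t' ∈ Set.Ico 0 T, ∀ x, 0 < ρ t' x * Rf (σ ^ 3 * ρ t' x) := by
    intro t' ht' x
    have hmem : σ ^ 3 * ρ t' x ∈ Set.Icc 0 r :=
      ⟨(hrange t' ht' x).1.le, ((hrange t' ht' x).2.trans_le hηsr).le⟩
    exact mul_pos (hE.density_pos t' ht' x) (one_pos.trans_le (hbd _ hmem).1)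
  have hθpos : ∀ t' ∈ Set.Ico 0 T, ∀ x, 0 < θ t' x := hE.temperature_pos
  -- the time-clamped one-body sum: jointly measurable, energy-dominated
  have hcm : ∀ r' : ℝ, max 0 (min r' (0 + t)) ∈ Set.Icc 0 (0 + t) := fun r' =>
    ⟨le_max_left _ _, max_le (by linarith) (min_le_right _ _)⟩
  have hcr : ∀ r' ∈ Set.Icc 0 t, max 0 (min r' (0 + t)) = r' := fun r' hr' => by
    rw [zero_add, min_eq_left hr'.2, max_eq_right hr'.1]
  have hFm := measurable_uncurry_gSum_clamp (N := N) hsm hE.smooth_temperature hE.smooth_velocity hapos hθpos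
    (s := 0) (h := t) le_rfl h0t htT'
  obtain ⟨Cg, hCg0, hCg⟩ := exists_abs_gExp_le_of_window (a := fun t' x => ρ t' x * Rf (σ ^ 3 * ρ t' x))
    hsm hE.smooth_temperature hE.smooth_velocity hapos hθpos (s := 0) (h := t) le_rfl htT'
  have hFC : ∀ (t' : ℝ) (w : Config (N + 1) (Fin 3) T3),
      |gSum (fun t' x => ρ t' x * Rf (σ ^ 3 * ρ t' x)) θ u (max 0 (min t' (0 + t))) w| ≤ Cg * ((N : ℝ) + 3) * (1 + configEnergy w) :=
    fun t' w => abs_gSum_le_of_window hCg0 (hCg _ (hcm t')) w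
  have hCf0 : 0 ≤ Cg * ((N : ℝ) + 3) := by positivity
  have hJm := measurable_compJump hσ hσi N hFm
  have hJD := abs_compJump_le (σ := σ) N hCf0 hFC
  refine ⟨fun q => Jcol σ Rf ρ θ u N (max 0 (min q.1 (0 + t))) q.2, 2 * (Cg * ((N : ℝ) + 3)), ?_, by positivity, ?_,
    fun t' w v hv hlt hne => ?_, fun q => ?_, fun t' ht' w => ?_⟩
  · exact hJm
  · exact hJD
  · exact Jcol_freeFlight σ Rf ρ θ u N _ w hv hlt hne
  · simp only [zero_add]
  · simp only [hcr t' ht']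

/-! ## §4 The reference frame along `[0, t]` and the heart's functionals on the clamped observables -/

/-- **Reference profiles along `[0,t]`**: continuity and positivity of the reference activity `ρ·Rf(σ³ρ)` (band `σ³ρ < r/2` inside the domain
of the insertion factor), temperature and velocity, and finiteness of the relative entropy of the law of `Λ_s` under local Gibbs data w.r.t.
the explicit reference (the ledger `…KlLedger.stub_klLedgerLambda`). [folklore] -/
theorem ref_frame {r : ℝ} {Rf : ℝ → ℝ} (hr : 0 < r) (hbd : ∀ x ∈ Set.Icc 0 r, 1 ≤ Rf x ∧ Rf x ≤ 2) (hcont : ContinuousOn Rf (Set.Icc 0 r))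
    {σ : ℝ} (hσ : 0 < σ) (hσi : σ < 2⁻¹) {a₀ θ₀ : T3 → ℝ} {u₀ : T3 → V3}
    (ha : Continuous a₀) (hθ : Continuous θ₀) (hu : Continuous u₀) (ha0 : ∀ x, 0 < a₀ x) (hθ0 : ∀ x, 0 < θ₀ x)
    {T : ℝ} {ρ θ : ℝ → T3 → ℝ} {u : ℝ → T3 → V3} (hE : IsHardSphereEulerSolution σ T ρ u θ)
    (hbandr : ∀ t' ∈ Set.Ico 0 T, ∀ x, ρ t' x * σ ^ 3 < r / 2) {t : ℝ} (htT : t < T)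
    (Φ : (N : ℕ) → HardSphereFlow (Torus.geometry (Fin 3)) (hsDiameter σ N) (N + 1)) :
    (∀ s ∈ Set.Icc 0 t, (Continuous fun x => ρ s x * Rf (σ ^ 3 * ρ s x)) ∧
      (∀ x, 0 < ρ s x * Rf (σ ^ 3 * ρ s x)) ∧ Continuous (θ s) ∧ Continuous (u s) ∧ ∀ x, 0 < θ s x) ∧
    (∀ (N : ℕ) (s : ℝ), s ∈ Set.Icc 0 t →
      klDiv (((localGibbsLaw σ a₀ u₀ θ₀ N (Φ N)).prod (lambertNoise (Fin 3))).map
          (fun p => lambertFlow (Torus.geometry (Fin 3)) (hsDiameter σ N) p.2 p.1 s))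
        (localGibbsLaw σ (fun x => ρ s x * Rf (σ ^ 3 * ρ s x)) (u s) (θ s) N (Φ N)) ≠ ⊤) := by
  have hPL : ∀ N, localGibbsLaw σ a₀ u₀ θ₀ N (Φ N) ≪ liouville (Torus.geometry (Fin 3)) (N + 1) (hsDiameter σ N) := by
    intro N; rw [localGibbsLaw, particleLaw_eq]; exact withDensity_absolutelyContinuous _ _
  have hσ2 : σ ≤ 1 / 2 := by rw [one_div]; exact hσi.le
  haveI hPlam : ∀ N, IsProbabilityMeasure (localGibbsLaw σ a₀ u₀ θ₀ N (Φ N)) := fun N =>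
    isProbabilityMeasure_localGibbsLaw ha hθ hu ha0 hθ0 hσ2 N (Φ N)
  have href : ∀ s ∈ Set.Icc 0 t, (Continuous fun x => ρ s x * Rf (σ ^ 3 * ρ s x)) ∧
      (∀ x, 0 < ρ s x * Rf (σ ^ 3 * ρ s x)) ∧ Continuous (θ s) ∧ Continuous (u s) ∧ ∀ x, 0 < θ s x := by
    intro s hs
    have hsI : s ∈ Set.Ico 0 T := ⟨hs.1, hs.2.trans_lt htT⟩
    have hρc : Continuous (ρ s) := (hE.smooth_density.isSmooth_slice hsI).continuous
    have huc : Continuous (u s) := (hE.smooth_velocity.isSmooth_slice hsI).continuous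
    have hθc : Continuous (θ s) := (hE.smooth_temperature.isSmooth_slice hsI).continuous
    have hρpos : ∀ x, 0 < ρ s x := hE.density_pos s hsI
    have hθpos : ∀ x, 0 < θ s x := hE.temperature_pos s hsI
    have hσ3 : 0 < σ ^ 3 := by positivity
    have hmem : ∀ x, σ ^ 3 * ρ s x ∈ Set.Icc 0 r := fun x => by
      have h := hbandr s hsI x
      exact ⟨(mul_pos hσ3 (hρpos x)).le, by nlinarith [h, hρpos x, hr]⟩
    have hbc : Continuous fun x => ρ s x * Rf (σ ^ 3 * ρ s x) :=
      hρc.mul (hcont.comp_continuous (continuous_const.mul hρc) hmem)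
    have hbpos : ∀ x, 0 < ρ s x * Rf (σ ^ 3 * ρ s x) := fun x =>
      mul_pos (hρpos x) (one_pos.trans_le (hbd _ (hmem x)).1)
    exact ⟨hbc, hbpos, hθc, huc, hθpos⟩
  have hfin : ∀ (N : ℕ) (s : ℝ), s ∈ Set.Icc 0 t →
      klDiv (((localGibbsLaw σ a₀ u₀ θ₀ N (Φ N)).prod (lambertNoise (Fin 3))).map
          (fun p => lambertFlow (Torus.geometry (Fin 3)) (hsDiameter σ N) p.2 p.1 s))
        (localGibbsLaw σ (fun x => ρ s x * Rf (σ ^ 3 * ρ s x)) (u s) (θ s) N (Φ N)) ≠ ⊤ := by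
    intro N s hs
    obtain ⟨hbc, hbpos, hθc, huc, hθpos⟩ := href s hs
    have hEn := QuenchedCellClock.integrable_sum_norm_sq_localGibbsLaw ha hθ hu (fun x => (ha0 x).le) hθ0 N (Φ N)
    have hK0 : klDiv (localGibbsLaw σ a₀ u₀ θ₀ N (Φ N)) (localGibbsLaw σ a₀ u₀ θ₀ N (Φ N)) ≠ ⊤ := by
      rw [klDiv_self]; exact ENNReal.zero_ne_top
    exact (LambertianContactSwapLambertianEulerKlLedger.stub_klLedgerLambda hσ hσi ha hθ hu ha0 hθ0 hbc hθc huc hbpos hθpos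
      N (Φ N) (localGibbsLaw σ a₀ u₀ θ₀ N (Φ N)) (hPL N) hEn hK0 s hs.1).1
  exact ⟨href, hfin⟩

/-- **The line's `Jmp` on a sub-interval of `[0,t]` is the expectation of the windowed jump sum of the time-clamped compensated jump** (the
counted contacts of `(a, b]` happen at times of `[0,t]`, off the null accumulation set). [folklore] -/
theorem Jmp_eq_clamped {σ : ℝ} (hσ : 0 < σ) (hσi : σ < 2⁻¹) {a₀ θ₀ : T3 → ℝ} {u₀ : T3 → V3} (N : ℕ)
    (Φ : HardSphereFlow (Torus.geometry (Fin 3)) (hsDiameter σ N) (N + 1)) {Rf : ℝ → ℝ} {ρ θ : ℝ → T3 → ℝ} {u : ℝ → T3 → V3} {t : ℝ}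
    {Jc : ℝ × Config (N + 1) (Fin 3) T3 → ℝ}
    (hJceq : ∀ t' ∈ Set.Icc 0 t, ∀ w : Config (N + 1) (Fin 3) T3, Jc (t', w) = Jcol σ Rf ρ θ u N t' w)
    {a' b : ℝ} (ha' : 0 ≤ a') (hab : a' ≤ b) (hbt : b ≤ t) :
    Jmp σ a₀ θ₀ u₀ Rf ρ θ u N Φ a' b =
      ∫ p, (∑ m ∈ Finset.range (lambertCount (Torus.geometry (Fin 3)) (hsDiameter σ N) p.2 p.1 b),
        if a' < (lambertInstant (Torus.geometry (Fin 3)) (hsDiameter σ N) p.2 p.1 (m + 1)).toReal then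
          Jc ((lambertInstant (Torus.geometry (Fin 3)) (hsDiameter σ N) p.2 p.1 (m + 1)).toReal,
            lambertStateAfter (Torus.geometry (Fin 3)) (hsDiameter σ N) p.2 p.1 m) else 0)
        ∂((localGibbsLaw σ a₀ u₀ θ₀ N Φ).prod (lambertNoise (Fin 3))) := by
  have hPL : localGibbsLaw σ a₀ u₀ θ₀ N Φ ≪ liouville (Torus.geometry (Fin 3)) (N + 1) (hsDiameter σ N) := by
    rw [localGibbsLaw, particleLaw_eq]; exact withDensity_absolutelyContinuous _ _
  have hacc := ae_nonAccumulation_of_absolutelyContinuous hσ hσi N _ hPL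
  rw [Jmp_eq]
  refine integral_congr_ae ?_
  filter_upwards [hacc] with p hp
  refine Finset.sum_congr rfl fun m hm => ?_
  split_ifs with hlt
  · have hle := instant_succ_le_of_lt_lambertCount (hp b) (Finset.mem_range.1 hm)
    have hTb : (lambertInstant (Torus.geometry (Fin 3)) (hsDiameter σ N) p.2 p.1 (m + 1)).toReal ≤ b :=
      ENNReal.toReal_le_of_le_ofReal (ha'.trans hab) hle
    rw [hJceq _ ⟨ha'.trans hlt.le, hTb.trans hbt⟩]
  · rfl

/-- **The line's `Xint` on a sub-interval of `[0,t]` is the window functional of the time-clamped counter-term.** [folklore] -/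
theorem Xint_eq_clamped {σ : ℝ} {a₀ θ₀ : T3 → ℝ} {u₀ : T3 → V3} (N : ℕ)
    (Φ : HardSphereFlow (Torus.geometry (Fin 3)) (hsDiameter σ N) (N + 1)) {ρ θ : ℝ → T3 → ℝ} {u : ℝ → T3 → V3} {t : ℝ}
    {GX : ℝ × (T3 × V3) → ℝ} (hGXeq : ∀ r' ∈ Set.Icc 0 t, ∀ y : T3 × V3, GX (r', y) = Xcol σ ρ θ u r' y)
    {a' b : ℝ} (ha' : 0 ≤ a') (hab : a' ≤ b) (hbt : b ≤ t) :
    Xint σ a₀ θ₀ u₀ ρ θ u N Φ a' b =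
      ∫ p, (∫ r' in a'..b, ∑ i, GX (r', lambertFlow (Torus.geometry (Fin 3)) (hsDiameter σ N) p.2 p.1 r' i))
        ∂((localGibbsLaw σ a₀ u₀ θ₀ N Φ).prod (lambertNoise (Fin 3))) := by
  rw [Xint_eq]
  refine integral_congr_ae (Eventually.of_forall fun p => intervalIntegral.integral_congr fun r' hr' => ?_)
  rw [Set.uIcc_of_le hab] at hr'
  exact Finset.sum_congr rfl fun i _ => (hGXeq r' ⟨ha'.trans hr'.1, hr'.2.trans hbt⟩ _).symm

end Summit.AtomisticToContinuum.HydrodynamicLimit.Theorems.LambertianContactSwapLambertianEulerCollisionalFrame
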